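import Summits.CriticalPhenomena.SAWScalingLimit.Theorems.SAWWeldingIdentificationSLERemovableChord
import HarnessLib

/-!
# Conformally-local Hölder banks of SLE₈/₃ chords (sanity pin for crux `RemovableLimit`, v2 stub)

Route `SAWWeldingIdentification`, crux stmt-CriticalPhenomena-4503 `RemovableLimit`, line `birth`
(skeleton v2, lead c1). The bank-regularity stub of the line, `stub_confHolderBanksLimit`, asks that
`P`-almost every limit curve `γ` of the critical SAW that is a simple chord of `(Ω; a, b)` be
CONFORMALLY-LOCALLY HÖLDER-BANKED in `Ω = Q.carrier`: every `z ∈ γ ∩ Ω` has an open neighbourhood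
`U ⊆ Ω`, an open `V` with a conformal equivalence `Ψ : V → U`, and a Hölder domain `H`
(`IsHolderDomain`, Jones–Smirnov 2000 p. 266) with `γ ∩ U ⊆ Ψ(∂H ∩ V)`.

This file certifies that statement on the conjectured value of the limit: for every conformal
rectangle `Q` and every chordal SLE₈/₃ random curve `Γ` in `(Ω; a, b) = Q.chord 0 2`, almost surely
`(Γ ω).range` is conformally-locally Hölder-banked in `Ω` (`sle83_ae_confLocallyHolderBanked`). So the
v2 stub is consistent with the summit conjunct `SAWScalingLimit` (whereas the v1 stub, a genuine
Hölder domain `H ⊆ ℂ` with `γ ∩ U ⊆ ∂H` in the `Ω`-picture, is not certified by tree tools: the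
carrier of a conformal rectangle is an arbitrary Jordan domain, whose Riemann map need not be Hölder).

## Proof

Verbatim the bookkeeping of `isConformallyRemovableIn_range_of_isCompactifiedImage`
(`SAWWeldingIdentificationSLERemovableChord.lean`), stopped one step earlier: near a point
`φ(γ(t₀))`, `t₀ < T = n + 1`, take `U = Ω ∖ c[s_T, 1]`, the chart `Ψ = (φ ∘ Cayley⁻¹)|_{V}`,
`V = Cayley(ℍ) ∩ Ψ⁻¹ U`, and `H` = Cayley image of the Loewner domain `ℍ ∖ γ(0, T]`, which is almost
surely a Hölder domain for every `T` (Rohde–Schramm 2005 Thm 5.2, tree theorem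
`RohdeSchramm2005_isHolderDomain_cayley_domain_holds`); the trace `γ(0, T]` lies on `∂(ℍ ∖ γ(0, T])`
(`cayleyFun_mem_frontier_image_domain`), the SLE₈/₃ trace being simple (Rohde–Schramm 2005 Thm 6.1,
`ae_isSimpleTrace_sleTrace_of_le_four_holds`).

## References

[RohdeSchramm2005] Thm 5.2, Thm 6.1; [JonesSmirnov2000] p. 266 (Hölder domains), Cor. 2.
-/

noncomputable section

open Set Filter Metric MeasureTheory Complex
open scoped NNReal Topology unitInterval
open UpperHalfPlane (upperHalfPlaneSet isOpen_upperHalfPlaneSet)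
open Literature.Probability.RandomPlanarGeometry

namespace Summit.CriticalPhenomena.SAWScalingLimit.Theorems.RemovableLimit

/-- **Hölder-bank bookkeeping.** Let the chain of the continuous driving function `W` be generated
by the simple curve `γ`, and suppose the Cayley images of the Loewner domains `H_{n+1}`, `n ∈ ℕ`,
are Hölder domains. Let `φ : ℍ → D` be a conformal equivalence onto the Dobrushin domain `D` whose
boundary extension sends `γ 0` off `D`, and let `c` be the time-compactified image of `γ` under `φ̄`
ending at `b = D.pt 1`. Then the trace of `c` is conformally-locally Hölder-banked in `D`: near a
point `φ(γ(t₀))`, `t₀ < T = n + 1`, inside the open set `U = D ∖ c[s_T, 1]` the trace is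
`⊆ φ(γ(0, T))`, the image under the conformal chart `Ψ = (φ ∘ Cayley⁻¹)|_V`, `V = Cayley(ℍ) ∩ Ψ⁻¹ U`,
of a subset of the frontier of the Hölder domain `Cayley(H_T)`.
[cite: RohdeSchramm2005, Thm 5.2; JonesSmirnov2000, p. 266] -/
theorem confLocallyHolderBanked_range_of_isCompactifiedImage
    {W : ℝ≥0 → ℝ} {γ : ℝ≥0 → ℂ} (hW : Continuous W)
    (hγ : Loewner.IsGeneratedByCurve W γ) (hs : Loewner.IsSimpleTrace γ)
    (hHol : ∀ n : ℕ, IsHolderDomain (cayleyFun '' Loewner.domain W ((n : ℝ≥0) + 1)))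
    (D : DobrushinDomain) (φ : ConformalEquiv upperHalfPlaneSet D.carrier)
    (ha : φ.boundaryExtension (γ 0) ∉ D.carrier) {c : Curve ℂ}
    (hc : IsCompactifiedImage φ.boundaryExtension γ (D.pt 1) c) :
    ∀ z ∈ c.range ∩ D.carrier, ∃ U : Set ℂ, IsOpen U ∧ z ∈ U ∧ U ⊆ D.carrier ∧
      ∃ (V : Set ℂ) (Ψ : ConformalEquiv V U) (H : Set ℂ), IsOpen V ∧ IsHolderDomain H ∧
        c.range ∩ U ⊆ Ψ '' (frontier H ∩ V) := by
  have hDo : IsOpen D.carrier := D.isOpen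
  have hb : D.pt 1 ∉ D.carrier := fun h =>
    (D.pt_mem_frontier 1).2 (by rwa [hDo.interior_eq])
  -- values of the compactified curve inside `D`
  have hval : ∀ s : I, c s ∈ D.carrier → (s : ℝ) < 1 ∧ 0 < rayParam s ∧
      γ (rayParam s) ∈ upperHalfPlaneSet ∧ c s = φ (γ (rayParam s)) := by
    intro s hsD
    have hs1 : (s : ℝ) < 1 := by
      by_contra h
      rw [unitInterval.eq_one_of_not_lt h, hc.2] at hsD
      exact hb hsD
    have hcs : c s = φ.boundaryExtension (γ (rayParam s)) := hc.1 s hs1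
    have h0 : 0 < rayParam s := by
      rcases eq_or_ne (rayParam s) 0 with h | h
      · rw [hcs, h] at hsD
        exact absurd hsD ha
      · exact pos_iff_ne_zero.2 h
    have hH : γ (rayParam s) ∈ upperHalfPlaneSet := hs.2 _ h0
    exact ⟨hs1, h0, hH, by rw [hcs, φ.boundaryExtension_eq hH]⟩
  rintro z ⟨⟨s, rfl⟩, hzD⟩
  obtain ⟨hs1, ht₀, hγt₀, hcs⟩ := hval s hzD
  -- the level `T = n + 1 > t₀`
  obtain ⟨n, hn⟩ := exists_nat_gt ((rayParam s : ℝ≥0) : ℝ)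
  have ht₀T : rayParam s < (n : ℝ≥0) + 1 := by
    have : ((rayParam s : ℝ≥0) : ℝ) < (n : ℝ) + 1 := by linarith
    exact_mod_cast this
  obtain ⟨sT, hsT1, hsT⟩ := exists_rayParam_eq ((n : ℝ≥0) + 1)
  -- the neighbourhood `D \ c[s_T, 1]`
  set Uz : Set ℂ := D.carrier \ c '' Icc sT 1 with hUz
  have hUo : IsOpen Uz := hDo.sdiff (isCompact_Icc.image c.continuous).isClosed
  -- points of the trace in `Uz` are `φ(γ(t'))` with `0 < t' < T`
  have htrace : ∀ s' : I, c s' ∈ Uz → (s' : ℝ) < 1 ∧ 0 < rayParam s' ∧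
      rayParam s' < (n : ℝ≥0) + 1 ∧ γ (rayParam s') ∈ upperHalfPlaneSet ∧
      c s' = φ (γ (rayParam s')) := by
    intro s' hs'
    obtain ⟨hs'1, h0, hH, hcs'⟩ := hval s' hs'.1
    have hlt : s' < sT := lt_of_not_ge fun h => hs'.2 ⟨s', ⟨h, s'.2.2⟩, rfl⟩
    refine ⟨hs'1, h0, ?_, hH, hcs'⟩
    rw [← hsT]
    exact lt_of_not_ge fun h => absurd ((rayParam_le_rayParam_iff hsT1 hs'1).1 h) (not_le.2 hlt)
  refine ⟨Uz, hUo, ⟨hzD, ?_⟩, sdiff_subset, ?_⟩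
  · -- `z = c s ∉ c[s_T, 1]`
    rintro ⟨s', hs', heq⟩
    by_cases hs'1 : (s' : ℝ) < 1
    · have hzD' : c s' ∈ D.carrier := heq ▸ hzD
      obtain ⟨-, h0', hH', hcs'⟩ := hval s' hzD'
      have hge : (n : ℝ≥0) + 1 ≤ rayParam s' := by
        rw [← hsT]
        exact (rayParam_le_rayParam_iff hsT1 hs'1).2 hs'.1
      have heq' : γ (rayParam s') = γ (rayParam s) :=
        φ.injOn hH' hγt₀ (by rw [← hcs', ← hcs, heq])
      have := hs.1 heq'
      rw [this] at hge
      exact absurd (hge.trans_lt ht₀T) (lt_irrefl _)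
    · rw [unitInterval.eq_one_of_not_lt hs'1, hc.2] at heq
      exact hb (heq ▸ hzD)
  · -- the chart: the disc picture of `ℍ`, composed with the uniformizing map, restricted to `Uz`
    obtain ⟨ψ₀, hψ₀, -⟩ := exists_conformalEquiv_image_cayleyFun (Subset.refl upperHalfPlaneSet)
    set Φ : ConformalEquiv (cayleyFun '' upperHalfPlaneSet) D.carrier := ψ₀.symm.trans φ with hΦ
    have hΦapply : ∀ x ∈ upperHalfPlaneSet, Φ (cayleyFun x) = φ x := fun x hx => by
      rw [hΦ, ConformalEquiv.trans_apply, ← hψ₀ x, ψ₀.symm_apply_apply hx]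
    set U' : Set ℂ := cayleyFun '' upperHalfPlaneSet ∩ Φ ⁻¹' Uz with hU'
    have hV : IsOpen (cayleyFun '' upperHalfPlaneSet) :=
      ConformalEquiv.isOpen_target_holds ψ₀ isOpen_upperHalfPlaneSet
    have hU'o : IsOpen U' := Φ.continuousOn.isOpen_inter_preimage hV hUo
    have hmaps : MapsTo Φ U' Uz := fun w hw => hw.2
    have hmaps' : MapsTo Φ.symm Uz U' := fun w hw =>
      ⟨Φ.symm_mapsTo hw.1, by
        show Φ (Φ.symm w) ∈ Uz
        rw [Φ.apply_symm_apply hw.1]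
        exact hw⟩
    set Ψ := Φ.restr U' Uz inter_subset_left sdiff_subset hmaps hmaps' with hΨ
    refine ⟨U', Ψ, cayleyFun '' Loewner.domain W ((n : ℝ≥0) + 1), hU'o, hHol n, ?_⟩
    rintro _ ⟨⟨s', rfl⟩, hpU⟩
    obtain ⟨-, h0, hT, hH, hcs'⟩ := htrace s' hpU
    refine ⟨cayleyFun (γ (rayParam s')), ⟨?_, ⟨γ (rayParam s'), hH, rfl⟩, ?_⟩, ?_⟩
    · exact cayleyFun_mem_frontier_image_domain hW hγ hs ⟨h0, hT.le⟩
    · show Φ (cayleyFun (γ (rayParam s'))) ∈ Uz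
      rw [hΦapply _ hH, ← hcs']
      exact hpU
    · show Φ (cayleyFun (γ (rayParam s'))) = c s'
      rw [hΦapply _ hH, ← hcs']

/-- **Chordal SLE₈/₃ is almost surely conformally-locally Hölder-banked** (sanity pin of the v2
bank-regularity stub `stub_confHolderBanksLimit` of crux stmt-CriticalPhenomena-4503 against the
conjectured value of the SAW limit): for every conformal rectangle `Q` and every chordal SLE₈/₃
random curve `Γ` in `(Ω; a, b) = Q.chord 0 2`, almost surely every point of `(Γ ω).range ∩ Ω` has
an open neighbourhood `U ⊆ Ω`, an open `V` with a conformal equivalence `Ψ : V → U` and a Hölder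
domain `H` with `(Γ ω).range ∩ U ⊆ Ψ(∂H ∩ V)` (Rohde–Schramm 2005 Thm 5.2, read through the
uniformiser; the trace is simple by Thm 6.1). [cite: RohdeSchramm2005, Thm 5.2 and Thm 6.1] -/
theorem sle83_ae_confLocallyHolderBanked :
    ∀ (Q : ConformalRectangle) (Γ : (ℝ≥0 → ℝ) → CurveClass ℂ),
      IsSLECurve ((8 : ℝ≥0) / 3) (Q.chord 0 2 (by decide)) Γ →
      ∀ᵐ ω ∂Literature.Probability.Process.preWienerMeasure,
        ∀ z ∈ (Γ ω).range ∩ Q.carrier, ∃ U : Set ℂ, IsOpen U ∧ z ∈ U ∧ U ⊆ Q.carrier ∧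
          ∃ (V : Set ℂ) (Ψ : ConformalEquiv V U) (H : Set ℂ), IsOpen V ∧ IsHolderDomain H ∧
            (Γ ω).range ∩ U ⊆ Ψ '' (frontier H ∩ V) := by
  intro Q Γ hΓ
  have hκ0 : (0 : ℝ≥0) < (8 : ℝ≥0) / 3 := by positivity
  have hκ4 : (8 : ℝ≥0) / 3 ≤ 4 := by
    rw [div_le_iff₀ (by norm_num : (0 : ℝ≥0) < 3)]
    norm_num
  have hκ4' : (8 : ℝ≥0) / 3 ≠ 4 := by
    refine ne_of_lt ?_
    rw [div_lt_iff₀ (by norm_num : (0 : ℝ≥0) < 3)]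
    norm_num
  have hκne : (8 : ℝ≥0) / 3 ≠ 0 := hκ0.ne'
  obtain ⟨-, φ, hφ, hae⟩ := hΓ
  have hHol : ∀ᵐ ω ∂Literature.Probability.Process.preWienerMeasure, ∀ n : ℕ,
      IsHolderDomain (cayleyFun '' Loewner.domain (sleDriving ((8 : ℝ≥0) / 3) ω) ((n : ℝ≥0) + 1)) :=
    ae_all_iff.2 fun n =>
      RohdeSchramm2005_isHolderDomain_cayley_domain_holds _ hκne hκ4' _ (by positivity)
  have hsimple : ∀ᵐ ω ∂Literature.Probability.Process.preWienerMeasure,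
      Loewner.IsSimpleTrace (sleTrace ((8 : ℝ≥0) / 3) ω) :=
    ae_isSimpleTrace_sleTrace_of_le_four_holds hκ0 hκ4
  filter_upwards [hae, hHol, hsimple] with ω hω hHol hs
  obtain ⟨hgen, c, hΓω, hc⟩ := hω
  have hrange : (Γ ω).range = c.range := by rw [hΓω, CurveClass.range_mk]
  have ha : φ.boundaryExtension (sleTrace ((8 : ℝ≥0) / 3) ω 0) ∉ (Q.chord 0 2 (by decide)).carrier := by
    rw [sleTrace_zero, hφ.boundaryExtension_zero]
    exact fun h => ((Q.chord 0 2 (by decide)).pt_mem_frontier 0).2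
      (by rwa [(Q.chord 0 2 (by decide)).isOpen.interior_eq])
  rw [hrange]
  exact confLocallyHolderBanked_range_of_isCompactifiedImage (continuous_sleDriving _ ω) hgen hs hHol
    (Q.chord 0 2 (by decide)) φ ha hc

end Summit.CriticalPhenomena.SAWScalingLimit.Theorems.RemovableLimit
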